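import Literature.Probability.RandomPlanarGeometry.YangBaxterSAWTwoPoint
import HarnessLib

/-!
# Glazman–Manolescu, Lemma 4.3: the last column weighs least at `π/3`

Topic `Literature/Probability/RandomPlanarGeometry`; second support file for the discharge of
`Literature.Probability.RandomPlanarGeometry.SAW.YangBaxter.GlazmanManolescu2019_thm1`
(`YangBaxterSAW.lean`, `YangBaxterSAWTwoPoint.lean`): A. Glazman, I. Manolescu, *Self-avoiding
walk on `ℤ²` with Yang–Baxter weights: universality of critical fugacity and 2-point function*,
Ann. Inst. Henri Poincaré Probab. Stat. 56 (2020), arXiv:1708.00395 (`GlazmanManolescu2019`),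
**Lemma 4.3** (p. 12): for angles `θ_k ∈ [π/3, 2π/3]` and `a, b` on the left boundary of
`Strip_T(Θ)`, `G_{Strip_T(Θ)}(a, b) ≥ G_{Strip_T(θ_1, …, θ_{T-1}, π/3)}(a, b)`. This file DISCHARGES
the named fact `GlazmanManolescu2019_lem43` of `YangBaxterSAWTwoPoint.lean`
(`GlazmanManolescu2019_lem43_holds`), following the printed proof walk by walk:

* "The intersection of `γ` with the rightmost column of `Strip_T(Θ)` is formed of a family of
  disjoint arcs … an arc `χ_j` is formed of a rhombus of type `u₁`, a number `k ≥ 0` of rhombi of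
  type `v` and one rhombus of type `u₂`": here, a walk between left-boundary points never crosses
  the right boundary (`YBWalk.vert_right_not_mem`), so every visited face of the last column
  carries exactly ONE arc, joining two of its sides `W, N, S` (`YBWalk.arc_unique_last`,
  `YBWalk.last_face_structure`), of type `u₁` (`{W,N}`), `u₂` (`{W,S}`) or `v` (`{N,S}`); and the
  numbers of `u₁`- and `u₂`-faces agree (`YBWalk.card_corner_eq_card_coCorner`: the faces whose arc
  uses their bottom side, resp. their top side, are both in bijection with the crossed slanted
  edges of the column). Hence the last column weighs `(u₁u₂)(θ_T)^p · v(θ_T)^q`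
  (`YBWalk.prod_last_eq`).
* "A direct computation shows that … the weight (4.3) is minimised when `θ_T = π/3`": with
  `X = cos(3θ/4 − 3π/8) ∈ [cos(π/8), 1]`, eq. (1) gives the closed forms
  `v(θ) = (X − sin(π/8)) / (X + cos(π/8))` (`weightV_eq`) and
  `u₁(θ)u₂(θ) = (X − sin(π/8)) / (X + cos(π/8))²` (`weightU1_mul_weightU2_eq`), both
  non-decreasing in `X`, and `X(π/3) = cos(π/8)` is the minimum of `X`
  (`weightV_pi_div_three_le`, `weightU1U2_pi_div_three_le`). (Note that `u₁` alone is NOT minimal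
  at `π/3` — `u₁(2π/3) = u₂(π/3) = x_c² < x_c = u₁(π/3)` —, which is why the pairing of `u₁`- and
  `u₂`-faces is needed.)
* The other columns weigh the same, and all local weights are `≥ 0` on `[π/3, 2π/3]`
  (`localWeight_nonneg`, "the weights above are all non-negative if and only if
  `θ ∈ [π/3, 2π/3]`", p. 2), so `w_{Θ̃}(γ) ≤ w_Θ(γ)` (`YBWalk.weight_update_last_le`) and summing
  over `γ` gives Lemma 4.3.

Also: general index calculus for the arcs of a `YBWalk` (`getElem_arcs`, `mem_arcs_iff`,
`faces_of_interior`: the two arcs at an interior crossed edge lie in its two bordering faces,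
`kindsIn_eq_singleton`, `nodup_arcs`), and `Face.sideOf_eq_some_iff`, `Face.side_injective`,
`MidEdge.commonFace_eq_some`, `exists_sides_of_arcFace`.

With this file, **Corollary 4.4**, eq. (4.5) — `G_{Strip_T(Θ)}(a, b) ≥ G_{Strip_T(π/3)}(a, b)` for
`a, b` on the left boundary — holds as soon as Proposition 4.2 does
(`GlazmanManolescu2019_cor44_of_prop42`; Corollary 4.4 is not a separate named fact: its printed proof
is exactly Proposition 4.2 + Lemma 4.3, formalised as `GlazmanManolescu2019_cor44_of` in
`YangBaxterSAWTwoPoint.lean`), and Theorem 1 reduces to Cor. 2.3, Prop. 1.1 (limit) and Prop. 4.2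
(`GlazmanManolescu2019_thm1_of_cor23_prop11_prop42`). The same inputs give **Theorem 2**
(`B_{T,Θ} → 0`, the named fact `GlazmanManolescu2019_thm2` of `YangBaxterSAW.lean`): Cor. 2.3 and
(4.5) give `B_{T,Θ} ≤ B_{T,π/3}` (`bridgePartitionFunction_le_hex`), and `B_{T,π/3} → 0`
(`GlazmanManolescu2019_thm2_of`, alias `GlazmanManolescu2019_thm2_of_cor23_prop11_prop42`; the
printed proof, §4.3, goes through `A_{T,Θ} → 1/cos(3π/8)` from the proof of Theorem 1).
-/

noncomputable section

open Real Filter Topology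
open scoped ENNReal

namespace Literature.Probability.RandomPlanarGeometry.SAW.YangBaxter

open MidEdge

/-! ### The local weights on `[π/3, 2π/3]`: signs, closed forms, monotonicity -/

section Trig

variable {θ : ℝ}

/-- `2 sin a sin b = cos(a − b) − cos(a + b)`. [folklore] -/
theorem two_mul_sin_mul_sin (a b : ℝ) : 2 * (sin a * sin b) = cos (a - b) - cos (a + b) := by
  rw [cos_add, cos_sub]; ring

/-- The bounds on `s = 3θ/8 ∈ [π/8, π/4]` for `θ ∈ [π/3, 2π/3]`. [folklore] -/
theorem three_mul_div_eight_mem (hθ : θ ∈ Set.Icc (π / 3) (2 * π / 3)) :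
    π / 8 ≤ 3 * θ / 8 ∧ 3 * θ / 8 ≤ π / 4 := by
  obtain ⟨h1, h2⟩ := hθ; constructor <;> linarith

/-- `sin(5π/4 + 3θ/8) = −sin(π/4 + 3θ/8)`. [folklore] -/
theorem sin_five_pi_div_four_add (θ : ℝ) : sin (5 * π / 4 + 3 * θ / 8) = -sin (π / 4 + 3 * θ / 8) := by
  rw [show 5 * π / 4 + 3 * θ / 8 = (π / 4 + 3 * θ / 8) + π by ring, sin_add_pi]

/-- The denominator of eq. (1) is negative on `[π/3, 2π/3]`. [cite: GlazmanManolescu2019, eq. (1)] -/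
theorem weightDen_neg (hθ : θ ∈ Set.Icc (π / 3) (2 * π / 3)) : weightDen θ < 0 := by
  obtain ⟨h1, h2⟩ := three_mul_div_eight_mem hθ
  have hpi := Real.pi_pos
  rw [weightDen, sin_five_pi_div_four_add, neg_mul, neg_lt_zero]
  refine mul_pos (sin_pos_of_pos_of_lt_pi (by linarith) (by linarith))
    (sin_pos_of_pos_of_lt_pi (by linarith) (by linarith))

/-- `sin(5π/8 + 3θ/8) > 0` on `[π/3, 2π/3]`. [folklore] -/
theorem sin_five_pi_div_eight_add_pos (hθ : θ ∈ Set.Icc (π / 3) (2 * π / 3)) :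
    0 < sin (5 * π / 8 + 3 * θ / 8) := by
  obtain ⟨h1, h2⟩ := three_mul_div_eight_mem hθ
  have hpi := Real.pi_pos
  exact sin_pos_of_pos_of_lt_pi (by linarith) (by linarith)

/-- `sin(3θ/8) > 0` on `[π/3, 2π/3]`. [folklore] -/
theorem sin_three_mul_div_eight_pos (hθ : θ ∈ Set.Icc (π / 3) (2 * π / 3)) : 0 < sin (3 * θ / 8) := by
  obtain ⟨h1, h2⟩ := three_mul_div_eight_mem hθ
  have hpi := Real.pi_pos
  exact sin_pos_of_pos_of_lt_pi (by linarith) (by linarith)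

/-- `sin(5π/4) < 0`. [folklore] -/
theorem sin_five_pi_div_four_neg : sin (5 * π / 4) < 0 := by
  rw [show (5 * π / 4 : ℝ) = π / 4 + π by ring, sin_add_pi, neg_lt_zero, sin_pi_div_four]
  positivity

/-- `u₁(θ) ≥ 0` on `[π/3, 2π/3]`. [cite: GlazmanManolescu2019, §1 ("the weights above are all non-negative if and only if θ ∈ [π/3,2π/3]")] -/
theorem weightU1_nonneg (hθ : θ ∈ Set.Icc (π / 3) (2 * π / 3)) : 0 ≤ weightU1 θ :=
  div_nonneg_of_nonpos (mul_nonpos_of_nonpos_of_nonneg sin_five_pi_div_four_neg.le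
    (sin_five_pi_div_eight_add_pos hθ).le) (weightDen_neg hθ).le

/-- `u₂(θ) ≥ 0` on `[π/3, 2π/3]`. [cite: GlazmanManolescu2019, §1] -/
theorem weightU2_nonneg (hθ : θ ∈ Set.Icc (π / 3) (2 * π / 3)) : 0 ≤ weightU2 θ :=
  div_nonneg_of_nonpos (mul_nonpos_of_nonpos_of_nonneg sin_five_pi_div_four_neg.le
    (sin_three_mul_div_eight_pos hθ).le) (weightDen_neg hθ).le

/-- `v(θ) ≥ 0` on `[π/3, 2π/3]`. [cite: GlazmanManolescu2019, §1] -/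
theorem weightV_nonneg (hθ : θ ∈ Set.Icc (π / 3) (2 * π / 3)) : 0 ≤ weightV θ := by
  refine div_nonneg_of_nonpos (mul_nonpos_of_nonneg_of_nonpos (sin_five_pi_div_eight_add_pos hθ).le ?_)
    (weightDen_neg hθ).le
  rw [sin_neg, neg_nonpos]; exact (sin_three_mul_div_eight_pos hθ).le

/-- `w₁(θ) ≥ 0` on `[π/3, 2π/3]`. [cite: GlazmanManolescu2019, §1] -/
theorem weightW1_nonneg (hθ : θ ∈ Set.Icc (π / 3) (2 * π / 3)) : 0 ≤ weightW1 θ := by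
  obtain ⟨h1, h2⟩ := three_mul_div_eight_mem hθ
  have hpi := Real.pi_pos
  refine div_nonneg_of_nonpos (mul_nonpos_of_nonneg_of_nonpos (sin_five_pi_div_eight_add_pos hθ).le ?_)
    (weightDen_neg hθ).le
  rw [show 5 * π / 4 - 3 * θ / 8 = (π / 4 - 3 * θ / 8) + π by ring, sin_add_pi, neg_nonpos]
  exact sin_nonneg_of_nonneg_of_le_pi (by linarith) (by linarith)

/-- `w₂(θ) ≥ 0` on `[π/3, 2π/3]`. [cite: GlazmanManolescu2019, §1] -/
theorem weightW2_nonneg (hθ : θ ∈ Set.Icc (π / 3) (2 * π / 3)) : 0 ≤ weightW2 θ := by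
  obtain ⟨h1, h2⟩ := three_mul_div_eight_mem hθ
  have hpi := Real.pi_pos
  refine div_nonneg_of_nonpos (mul_nonpos_of_nonneg_of_nonpos ?_ ?_) (weightDen_neg hθ).le
  · rw [show 15 * π / 8 + 3 * θ / 8 = (3 * θ / 8 - π / 8) + 2 * π by ring, sin_add_two_pi]
    exact sin_nonneg_of_nonneg_of_le_pi (by linarith) (by linarith)
  · rw [sin_neg, neg_nonpos]; exact (sin_three_mul_div_eight_pos hθ).le

/-- All local weights are `≥ 0` for `θ ∈ [π/3, 2π/3]`. [cite: GlazmanManolescu2019, §1] -/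
theorem localWeight_nonneg (hθ : θ ∈ Set.Icc (π / 3) (2 * π / 3)) (l : List ArcKind) :
    0 ≤ localWeight θ l := by
  unfold localWeight
  split
  · exact zero_le_one
  · exact weightU1_nonneg hθ
  · exact weightU2_nonneg hθ
  · exact weightV_nonneg hθ
  · exact weightW1_nonneg hθ
  · exact weightW2_nonneg hθ
  · exact le_rfl

/-- The weight of a walk is `≥ 0` when all angles are in `[π/3, 2π/3]`. [cite: GlazmanManolescu2019, §1] -/
theorem YBWalk.weight_nonneg {D : Set Face} {a z : MidEdge} (γ : YBWalk D a z) {Θ : ℤ → ℝ}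
    (hΘ : ∀ k, Θ k ∈ Set.Icc (π / 3) (2 * π / 3)) : 0 ≤ γ.weight Θ :=
  Finset.prod_nonneg fun f _ => localWeight_nonneg (hΘ f.1) _

/-- The variable `X(θ) = cos(3θ/4 − 3π/8) ∈ [cos(π/8), 1]` of the closed forms below. [folklore] -/
def auxCos (θ : ℝ) : ℝ := cos (3 * θ / 4 - 3 * π / 8)

/-- `2 sin(π/4 + 3θ/8) sin(5π/8 − 3θ/8) = X(θ) + cos(π/8)`. [folklore] -/
theorem two_mul_den' (θ : ℝ) :
    2 * (sin (π / 4 + 3 * θ / 8) * sin (5 * π / 8 - 3 * θ / 8)) = auxCos θ + cos (π / 8) := by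
  rw [two_mul_sin_mul_sin, auxCos, show π / 4 + 3 * θ / 8 - (5 * π / 8 - 3 * θ / 8) = 3 * θ / 4 - 3 * π / 8 by ring,
    show π / 4 + 3 * θ / 8 + (5 * π / 8 - 3 * θ / 8) = π - π / 8 by ring, cos_pi_sub]
  ring

/-- `2 sin(5π/8 + 3θ/8) sin(3θ/8) = X(θ) − sin(π/8)`. [folklore] -/
theorem two_mul_num' (θ : ℝ) :
    2 * (sin (5 * π / 8 + 3 * θ / 8) * sin (3 * θ / 8)) = auxCos θ - sin (π / 8) := by
  rw [two_mul_sin_mul_sin, auxCos, show 5 * π / 8 + 3 * θ / 8 - 3 * θ / 8 = π / 8 + π / 2 by ring,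
    show 5 * π / 8 + 3 * θ / 8 + 3 * θ / 8 = (3 * θ / 4 - 3 * π / 8) + π by ring, cos_add_pi,
    cos_add_pi_div_two]
  ring

/-- **Closed form of `v`**: `v(θ) = (X − sin(π/8)) / (X + cos(π/8))`, `X = cos(3θ/4 − 3π/8)`.
[cite: GlazmanManolescu2019, eq. (1)] -/
theorem weightV_eq (θ : ℝ) : weightV θ = (auxCos θ - sin (π / 8)) / (auxCos θ + cos (π / 8)) := by
  rw [weightV, weightDen, sin_five_pi_div_four_add, sin_neg, ← two_mul_num', ← two_mul_den']
  rw [mul_neg, neg_mul, neg_div_neg_eq, mul_div_mul_left _ _ (two_ne_zero)]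

/-- **Closed form of `u₁ u₂`**: `u₁(θ) u₂(θ) = (X − sin(π/8)) / (X + cos(π/8))²`.
[cite: GlazmanManolescu2019, eq. (1)] -/
theorem weightU1_mul_weightU2_eq (θ : ℝ) :
    weightU1 θ * weightU2 θ = (auxCos θ - sin (π / 8)) / (auxCos θ + cos (π / 8)) ^ 2 := by
  have h2 : sin (5 * π / 4) ^ 2 = 1 / 2 := by
    rw [show (5 * π / 4 : ℝ) = π / 4 + π by ring, sin_add_pi, neg_sq, sin_pi_div_four, div_pow,
      Real.sq_sqrt (by norm_num)]
    norm_num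
  have hden : weightDen θ ^ 2 = (auxCos θ + cos (π / 8)) ^ 2 / 4 := by
    rw [weightDen, sin_five_pi_div_four_add, neg_mul, neg_sq, ← two_mul_den']; ring
  have hnum : sin (5 * π / 8 + 3 * θ / 8) * sin (3 * θ / 8) = (auxCos θ - sin (π / 8)) / 2 := by
    rw [← two_mul_num']; ring
  calc weightU1 θ * weightU2 θ
      = sin (5 * π / 4) ^ 2 * (sin (5 * π / 8 + 3 * θ / 8) * sin (3 * θ / 8)) / weightDen θ ^ 2 := by
        rw [weightU1, weightU2]; ring
    _ = (auxCos θ - sin (π / 8)) / (auxCos θ + cos (π / 8)) ^ 2 := by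
        rw [h2, hden, hnum]
        rcases eq_or_ne (auxCos θ + cos (π / 8)) 0 with h | h
        · rw [h]; simp
        · field_simp
          ring

/-- `cos(π/8) ≤ X(θ) ≤ 1` on `[π/3, 2π/3]` and `X(π/3) = cos(π/8)`. [folklore] -/
theorem cos_pi_div_eight_le_auxCos (hθ : θ ∈ Set.Icc (π / 3) (2 * π / 3)) : cos (π / 8) ≤ auxCos θ := by
  obtain ⟨h1, h2⟩ := hθ
  have hpi := Real.pi_pos
  rw [auxCos, ← Real.cos_abs (3 * θ / 4 - 3 * π / 8)]
  exact cos_le_cos_of_nonneg_of_le_pi (abs_nonneg _) (by linarith) (abs_le.2 ⟨by linarith, by linarith⟩)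

/-- `X(π/3) = cos(π/8)`. [folklore] -/
theorem auxCos_pi_div_three : auxCos (π / 3) = cos (π / 8) := by
  rw [auxCos, show 3 * (π / 3) / 4 - 3 * π / 8 = -(π / 8) by ring, cos_neg]

/-- `sin(π/8) > 0`. [folklore] -/
theorem sin_pi_div_eight_pos : 0 < sin (π / 8) := sin_pos_of_pos_of_lt_pi (by positivity) (by linarith [Real.pi_pos])

/-- `sin(π/8) < cos(π/8)`. [folklore] -/
theorem sin_pi_div_eight_lt_cos : sin (π / 8) < cos (π / 8) := by
  rw [← Real.sin_pi_div_two_sub]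
  exact sin_lt_sin_of_lt_of_le_pi_div_two (by linarith [Real.pi_pos]) (by linarith [Real.pi_pos])
    (by linarith [Real.pi_pos])

/-- `4 sin(π/8) cos(π/8) = 2 sin(π/4) = √2`. [folklore] -/
theorem four_mul_sin_mul_cos_pi_div_eight : 4 * (sin (π / 8) * cos (π / 8)) = Real.sqrt 2 := by
  have : sin (π / 4) = 2 * sin (π / 8) * cos (π / 8) := by
    rw [← sin_two_mul]; congr 1; ring
  rw [sin_pi_div_four] at this
  linarith

/-- **`v` is minimal at `π/3`** on `[π/3, 2π/3]` ("a direct computation shows that … the weight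
is minimised when `θ_T = π/3`"). [cite: GlazmanManolescu2019, proof of Lemma 4.3] -/
theorem weightV_pi_div_three_le (hθ : θ ∈ Set.Icc (π / 3) (2 * π / 3)) : weightV (π / 3) ≤ weightV θ := by
  rw [weightV_eq, weightV_eq, auxCos_pi_div_three]
  have hA := sin_pi_div_eight_pos
  have hAB := sin_pi_div_eight_lt_cos
  have hX := cos_pi_div_eight_le_auxCos hθ
  rw [div_le_div_iff₀ (by linarith) (by linarith)]
  nlinarith

/-- **`u₁ u₂` is minimal at `π/3`** on `[π/3, 2π/3]`. [cite: GlazmanManolescu2019, proof of Lemma 4.3] -/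
theorem weightU1U2_pi_div_three_le (hθ : θ ∈ Set.Icc (π / 3) (2 * π / 3)) :
    weightU1 (π / 3) * weightU2 (π / 3) ≤ weightU1 θ * weightU2 θ := by
  rw [weightU1_mul_weightU2_eq, weightU1_mul_weightU2_eq, auxCos_pi_div_three]
  have hA := sin_pi_div_eight_pos
  have hAB := sin_pi_div_eight_lt_cos
  have hX := cos_pi_div_eight_le_auxCos hθ
  have hX1 : auxCos θ ≤ 1 := cos_le_one _
  have hB1 : cos (π / 8) ≤ 1 := cos_le_one _
  have h4 : 1 ≤ 4 * (sin (π / 8) * cos (π / 8)) := by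
    rw [four_mul_sin_mul_cos_pi_div_eight]
    exact Real.one_lt_sqrt_two.le
  rw [div_le_div_iff₀ (by nlinarith) (by nlinarith)]
  -- with D = X − B ≥ 0: 4B²(X−A) − (B−A)(X+B)² = D (4AB − D (B − A)) ≥ 0
  have key : (cos (π / 8) - sin (π / 8)) * (auxCos θ + cos (π / 8)) ^ 2 ≤
      (auxCos θ - sin (π / 8)) * (cos (π / 8) + cos (π / 8)) ^ 2 := by
    nlinarith [mul_nonneg (sub_nonneg.2 hX) (sub_nonneg.2 hX), mul_nonneg (sub_nonneg.2 hX) (sub_nonneg.2 hX1),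
      mul_nonneg (sub_nonneg.2 hX) hA.le]
  linarith

end Trig

/-! ### Sides and faces -/

namespace Face

/-- `sideOf` is the inverse of `side`. [folklore] -/
theorem sideOf_eq_some_iff (f : Face) (e : MidEdge) (s : Side) : f.sideOf e = some s ↔ f.side s = e := by
  obtain ⟨k₀, j₀⟩ := f
  cases e with
  | vert k j =>
    cases s <;> simp only [sideOf, side] <;> split_ifs <;> simp_all <;> omega
  | slant k j =>
    cases s <;> simp only [sideOf, side] <;> split_ifs <;> simp_all <;> omega

/-- `sideOf` recovers the side. [folklore] -/
@[simp] theorem sideOf_side (f : Face) (s : Side) : f.sideOf (f.side s) = some s :=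
  (sideOf_eq_some_iff f _ s).2 rfl

/-- `side` is injective. [folklore] -/
theorem side_injective (f : Face) : Function.Injective f.side := fun s t h => by
  have := sideOf_side f s
  rw [h, sideOf_side] at this
  exact (Option.some_injective _ this).symm

/-- The faces bordering a mid-edge are those of which it is a side. [folklore] -/
theorem exists_side_eq_iff (f : Face) (e : MidEdge) : (∃ s, f.side s = e) ↔ (f = e.faces.1 ∨ f = e.faces.2) := by
  obtain ⟨k₀, j₀⟩ := f
  constructor
  · rintro ⟨s, rfl⟩
    cases s <;> simp [side, faces]
  · intro h
    cases e with
    | vert k j =>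
      simp only [faces, Prod.mk.injEq] at h
      rcases h with ⟨rfl, rfl⟩ | ⟨rfl, rfl⟩
      · exact ⟨.E, by simp [side]⟩
      · exact ⟨.W, rfl⟩
    | slant k j =>
      simp only [faces, Prod.mk.injEq] at h
      rcases h with ⟨rfl, rfl⟩ | ⟨rfl, rfl⟩
      · exact ⟨.N, by simp [side]⟩
      · exact ⟨.S, rfl⟩

end Face

namespace MidEdge

/-- A common face of `e, e'` is bordered by both, and `e ≠ e'`. [folklore] -/
theorem commonFace_eq_some {e e' : MidEdge} {f : Face} (h : commonFace e e' = some f) :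
    e ≠ e' ∧ (f = e.faces.1 ∨ f = e.faces.2) ∧ (f = e'.faces.1 ∨ f = e'.faces.2) := by
  unfold commonFace at h
  split_ifs at h with h1 h2 h3 <;> simp only [Option.some.injEq] at h <;> subst h <;>
    refine ⟨h1, ?_, ?_⟩ <;> tauto

/-- If `f` is a common face of `e ≠ e'` then `commonFace e e'` is defined (it may be the other
common face only if ... there is at most one: two distinct edges of the grid share at most one
face). [folklore] -/
theorem commonFace_isSome {e e' : MidEdge} (hne : e ≠ e') {f : Face}
    (h1 : f = e.faces.1 ∨ f = e.faces.2) (h2 : f = e'.faces.1 ∨ f = e'.faces.2) :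
    ∃ f', commonFace e e' = some f' ∧ (f' = e.faces.1 ∨ f' = e.faces.2) ∧ (f' = e'.faces.1 ∨ f' = e'.faces.2) := by
  unfold commonFace
  rw [if_neg hne]
  split_ifs with h3 h4
  · exact ⟨_, rfl, Or.inl rfl, h3⟩
  · exact ⟨_, rfl, Or.inr rfl, h4⟩
  · exfalso
    rcases h1 with rfl | rfl
    · exact h3 h2
    · exact h4 h2

end MidEdge

/-- The two components of an arc drawn in `f` are two distinct sides of `f`, and the kind of the
arc is read from them. [folklore] -/
theorem exists_sides_of_arcFace {p : MidEdge × MidEdge} {f : Face} (h : arcFace p = some f) :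
    ∃ s t : Side, s ≠ t ∧ f.side s = p.1 ∧ f.side t = p.2 ∧ arcKindOf p = some (arcKind s t) := by
  obtain ⟨hne, h1, h2⟩ := MidEdge.commonFace_eq_some h
  obtain ⟨s, hs⟩ := (Face.exists_side_eq_iff f p.1).2 h1
  obtain ⟨t, ht⟩ := (Face.exists_side_eq_iff f p.2).2 h2
  refine ⟨s, t, fun hst => hne (by rw [← hs, ← ht, hst]), hs, ht, ?_⟩
  unfold arcKindOf
  rw [h, Option.bind_some, ← hs, ← ht, Face.sideOf_side, Face.sideOf_side]

/-! ### Arcs of a walk by index -/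

namespace YBWalk

variable {D : Set Face} {a z : MidEdge}

/-- A walk crossing `n + 1` mid-edges has `n` arcs. [folklore] -/
theorem length_arcs (γ : YBWalk D a z) : γ.arcs.length = γ.mids.length - 1 := by
  simp [arcsOf, List.length_zip]

/-- The `i`-th arc joins the `i`-th and `(i+1)`-st mid-edges. [folklore] -/
theorem getElem_arcs (γ : YBWalk D a z) {i : ℕ} (hi : i < γ.arcs.length) :
    γ.arcs[i] = (γ.mids[i]'(by rw [length_arcs] at hi; omega),
      γ.mids[i + 1]'(by rw [length_arcs] at hi; omega)) := by
  simp [arcsOf, List.getElem_zip, List.getElem_tail]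

/-- Arcs are the pairs of consecutive mid-edges. [folklore] -/
theorem mem_arcs_iff (γ : YBWalk D a z) {p : MidEdge × MidEdge} :
    p ∈ γ.arcs ↔ ∃ (i : ℕ) (hi : i + 1 < γ.mids.length), p = (γ.mids[i], γ.mids[i + 1]) := by
  rw [List.mem_iff_getElem]
  constructor
  · rintro ⟨i, hi, rfl⟩
    exact ⟨i, by rw [length_arcs] at hi; omega, γ.getElem_arcs hi⟩
  · rintro ⟨i, hi, rfl⟩
    exact ⟨i, by rw [length_arcs]; omega, γ.getElem_arcs _⟩

/-- Consecutive mid-edges form an arc. [folklore] -/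
theorem mk_mem_arcs (γ : YBWalk D a z) {i : ℕ} (hi : i + 1 < γ.mids.length) :
    (γ.mids[i], γ.mids[i + 1]) ∈ γ.arcs :=
  γ.mem_arcs_iff.2 ⟨i, hi, rfl⟩

/-- The components of an arc are crossed mid-edges, and distinct. [folklore] -/
theorem mem_of_mem_arcs (γ : YBWalk D a z) {p : MidEdge × MidEdge} (hp : p ∈ γ.arcs) :
    p.1 ∈ γ.mids ∧ p.2 ∈ γ.mids ∧ p.1 ≠ p.2 := by
  obtain ⟨i, hi, rfl⟩ := γ.mem_arcs_iff.1 hp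
  refine ⟨List.getElem_mem _, List.getElem_mem _, fun h => ?_⟩
  have := (γ.nodup.getElem_inj_iff).1 h
  omega

/-- Consecutive arcs are drawn in different faces. [cite: GlazmanManolescu2019, §1] -/
theorem arcFace_ne_succ (γ : YBWalk D a z) {i : ℕ} (hi : i + 2 < γ.mids.length) :
    arcFace (γ.mids[i], γ.mids[i + 1]) ≠ arcFace (γ.mids[i + 1], γ.mids[i + 2]) := by
  have h := List.isChain_iff_getElem.1 γ.isChain i (by rw [length_arcs]; omega)
  rwa [γ.getElem_arcs, γ.getElem_arcs] at h

/-- Every arc is drawn in a face of the domain. [cite: GlazmanManolescu2019, §1] -/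
theorem exists_arcFace (γ : YBWalk D a z) {i : ℕ} (hi : i + 1 < γ.mids.length) :
    ∃ f ∈ D, arcFace (γ.mids[i], γ.mids[i + 1]) = some f :=
  γ.arc_mem _ (γ.mk_mem_arcs hi)

/-- A walk crosses at least one mid-edge. [folklore] -/
theorem length_pos (γ : YBWalk D a z) : 0 < γ.mids.length := List.length_pos_iff.2 γ.mids_ne_nil

/-- The first mid-edge is `a`. [folklore] -/
theorem getElem_zero (γ : YBWalk D a z) : γ.mids[0]'γ.length_pos = a := by
  have := γ.head_eq
  rw [List.head?_eq_getElem?, List.getElem?_eq_getElem γ.length_pos] at this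
  exact Option.some_injective _ this

/-- The last mid-edge is `z`. [folklore] -/
theorem getElem_length_sub_one (γ : YBWalk D a z) :
    γ.mids[γ.mids.length - 1]'(by have := γ.length_pos; omega) = z := by
  have := γ.getLast_eq
  rw [List.getLast?_eq_getElem?, List.getElem?_eq_getElem (by have := γ.length_pos; omega)] at this
  exact Option.some_injective _ this

/-- A crossed mid-edge other than the endpoints has an interior index. [folklore] -/
theorem exists_index_of_interior (γ : YBWalk D a z) {e : MidEdge} (he : e ∈ γ.mids) (ha : e ≠ a)
    (hz : e ≠ z) : ∃ (i : ℕ) (_ : 0 < i) (_ : i + 1 < γ.mids.length), γ.mids[i] = e := by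
  obtain ⟨i, hi, rfl⟩ := List.mem_iff_getElem.1 he
  refine ⟨i, Nat.pos_of_ne_zero fun h => ha ?_, ?_, rfl⟩
  · subst h; exact γ.getElem_zero
  · by_contra h
    have : i = γ.mids.length - 1 := by omega
    subst this
    exact hz γ.getElem_length_sub_one

/-- **The two arcs at an interior mid-edge.** Every face bordering a crossed mid-edge `e` other
than the endpoints is a face of the domain and carries an arc of the walk ending or starting at
`e` (the two arcs at `e` lie in different faces, and `e` borders only two).
[cite: GlazmanManolescu2019, §1 ("intersecting edges at right angles")] -/
theorem faces_of_interior (γ : YBWalk D a z) {e : MidEdge} (he : e ∈ γ.mids) (ha : e ≠ a) (hz : e ≠ z)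
    (f : Face) (hf : f = e.faces.1 ∨ f = e.faces.2) :
    f ∈ D ∧ ∃ p ∈ γ.arcs, arcFace p = some f ∧ (p.1 = e ∨ p.2 = e) := by
  obtain ⟨i, h0, hi, rfl⟩ := γ.exists_index_of_interior he ha hz
  obtain ⟨j, rfl⟩ : ∃ j, i = j + 1 := ⟨i - 1, by omega⟩
  obtain ⟨f₁, hf₁D, hf₁⟩ := γ.exists_arcFace (i := j) (by omega)
  obtain ⟨f₂, hf₂D, hf₂⟩ := γ.exists_arcFace (i := j + 1) hi
  have hne : f₁ ≠ f₂ := by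
    intro h
    have := γ.arcFace_ne_succ (i := j) (by omega)
    rw [hf₁, hf₂, h] at this
    exact this rfl
  obtain ⟨-, -, hf₁e⟩ := MidEdge.commonFace_eq_some hf₁
  obtain ⟨-, hf₂e, -⟩ := MidEdge.commonFace_eq_some hf₂
  have key : f = f₁ ∨ f = f₂ := by
    rcases hf with rfl | rfl <;> rcases hf₁e with h1 | h1 <;> rcases hf₂e with h2 | h2 <;>
      first | exact Or.inl h1.symm | exact Or.inr h2.symm | exact absurd (h1.trans h2.symm) hne
  rcases key with rfl | rfl
  · exact ⟨hf₁D, _, γ.mk_mem_arcs (i := j) (by omega), hf₁, Or.inr rfl⟩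
  · exact ⟨hf₂D, _, γ.mk_mem_arcs hi, hf₂, Or.inl rfl⟩

/-- The list of arcs has no duplicates. [folklore] -/
theorem nodup_arcs (γ : YBWalk D a z) : γ.arcs.Nodup := by
  have h : (γ.arcs.map Prod.snd) = γ.mids.tail := by
    simp [arcsOf, List.map_snd_zip]
  have : (γ.arcs.map Prod.snd).Nodup := by rw [h]; exact γ.nodup.sublist (List.tail_sublist _)
  exact this.of_map _

/-- If a face carries exactly one arc `p` of the walk, `kindsIn` lists the kind of `p` only.
[folklore] -/
theorem kindsIn_eq_singleton (γ : YBWalk D a z) {f : Face} {p : MidEdge × MidEdge} (hp : p ∈ γ.arcs)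
    (hpf : arcFace p = some f) (huniq : ∀ q ∈ γ.arcs, arcFace q = some f → q = p) {κ : ArcKind}
    (hκ : arcKindOf p = some κ) : γ.kindsIn f = [κ] := by
  obtain ⟨L₁, L₂, hL⟩ := List.append_of_mem hp
  have hnd := γ.nodup_arcs
  unfold kindsIn
  rw [hL] at hnd huniq ⊢
  have hp₁ : p ∉ L₁ := fun h => List.disjoint_of_nodup_append hnd h List.mem_cons_self
  have hp₂ : p ∉ L₂ := (List.nodup_cons.1 (List.nodup_append.1 hnd).2.1).1
  have hnone : ∀ q, q ∈ L₁ ∨ q ∈ L₂ → (if arcFace q = some f then arcKindOf q else none) = none := by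
    intro q hq
    split_ifs with hqf
    · have := huniq q (by simp; tauto) hqf
      subst this
      exact absurd hq (by tauto)
    · rfl
  rw [List.filterMap_append, List.filterMap_cons_some (by rw [if_pos hpf, hκ]),
    List.filterMap_eq_nil_iff.2 fun q hq => hnone q (Or.inl hq),
    List.filterMap_eq_nil_iff.2 fun q hq => hnone q (Or.inr hq)]
  rfl

/-- A visited face carries an arc. [folklore] -/
theorem exists_arc_of_mem_facesVisited (γ : YBWalk D a z) {f : Face} (hf : f ∈ γ.facesVisited) :
    ∃ p ∈ γ.arcs, arcFace p = some f := by
  simpa [facesVisited, List.mem_filterMap] using hf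

/-- The face of an arc is visited. [folklore] -/
theorem mem_facesVisited_of_arcFace (γ : YBWalk D a z) {f : Face} {p : MidEdge × MidEdge} (hp : p ∈ γ.arcs)
    (hpf : arcFace p = some f) : f ∈ γ.facesVisited := by
  simp only [facesVisited, List.mem_toFinset, List.mem_filterMap]
  exact ⟨p, hp, hpf⟩

end YBWalk

/-! ### Walks of a strip between left-boundary points: the last column -/

namespace YBWalk

variable {T : ℕ} {m n : ℤ}

/-- A walk of `Strip_T` between two points of its left boundary never reaches the right boundary:
a crossed right-boundary edge would have its two arcs in two different faces of the strip
bordering it, but only one face of the strip borders it. [cite: GlazmanManolescu2019, §4.2] -/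
theorem vert_right_not_mem (hT : 1 ≤ T) (γ : YBWalk (strip T) (boundaryPoint m) (boundaryPoint n))
    (j : ℤ) : MidEdge.vert T j ∉ γ.mids := by
  intro he
  have h := (γ.faces_of_interior he (by simp [boundaryPoint]; omega) (by simp [boundaryPoint]; omega)
    ((T : ℤ), j) (Or.inr rfl)).1
  exact lt_irrefl _ h.2

/-- In a face of the last column, the sides joined by an arc of such a walk are not the right side
`E`. [cite: GlazmanManolescu2019, proof of Lemma 4.3] -/
theorem sides_of_arcFace_last (hT : 1 ≤ T) (γ : YBWalk (strip T) (boundaryPoint m) (boundaryPoint n))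
    {f : Face} (hf : f.1 = (T : ℤ) - 1) {p : MidEdge × MidEdge} (hp : p ∈ γ.arcs) (hpf : arcFace p = some f) :
    ∃ s t : Side, s ≠ t ∧ s ≠ .E ∧ t ≠ .E ∧ f.side s = p.1 ∧ f.side t = p.2 ∧
      arcKindOf p = some (arcKind s t) := by
  obtain ⟨s, t, hst, hs, ht, hk⟩ := exists_sides_of_arcFace hpf
  obtain ⟨h1, h2, -⟩ := γ.mem_of_mem_arcs hp
  have hE : f.side .E ∉ γ.mids := by
    have : f.side .E = .vert T f.2 := by simp [Face.side, hf]
    rw [this]; exact γ.vert_right_not_mem hT f.2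
  refine ⟨s, t, hst, ?_, ?_, hs, ht, hk⟩
  · rintro rfl; exact hE (hs ▸ h1)
  · rintro rfl; exact hE (ht ▸ h2)

/-- Four pairwise distinct sides cannot all avoid `E`. [folklore] -/
theorem _root_.Literature.Probability.RandomPlanarGeometry.SAW.YangBaxter.Side.not_four_ne_E
    (a b c d : Side) (ha : a ≠ .E) (hb : b ≠ .E) (hc : c ≠ .E) (hd : d ≠ .E)
    (h1 : a ≠ b) (h2 : a ≠ c) (h3 : a ≠ d) (h4 : b ≠ c) (h5 : b ≠ d) (h6 : c ≠ d) : False := by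
  cases a <;> cases b <;> cases c <;> cases d <;> simp_all

/-- **A face of the last column carries at most one arc** of a walk between left-boundary points:
two arcs would need four distinct sides among `W, N, S`. [cite: GlazmanManolescu2019, proof of
Lemma 4.3 ("the intersection of γ with the rightmost column … is formed of a family of disjoint arcs")] -/
theorem arc_unique_last (hT : 1 ≤ T) (γ : YBWalk (strip T) (boundaryPoint m) (boundaryPoint n))
    {f : Face} (hf : f.1 = (T : ℤ) - 1) {p q : MidEdge × MidEdge} (hp : p ∈ γ.arcs) (hq : q ∈ γ.arcs)
    (hpf : arcFace p = some f) (hqf : arcFace q = some f) : p = q := by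
  -- a symmetric formulation on indices
  suffices key : ∀ {i k : ℕ} (hi : i + 1 < γ.mids.length) (hk : k + 1 < γ.mids.length), i < k →
      arcFace (γ.mids[i], γ.mids[i + 1]) = some f → arcFace (γ.mids[k], γ.mids[k + 1]) = some f → False by
    obtain ⟨i, hi, rfl⟩ := γ.mem_arcs_iff.1 hp
    obtain ⟨k, hk, rfl⟩ := γ.mem_arcs_iff.1 hq
    rcases lt_trichotomy i k with h | rfl | h
    · exact (key hi hk h hpf hqf).elim
    · rfl
    · exact (key hk hi h hqf hpf).elim
  intro i k hi hk hlt hpf hqf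
  rcases eq_or_lt_of_le (Nat.succ_le_of_lt hlt) with h' | h'
  · subst h'; exact γ.arcFace_ne_succ hk (hpf.trans hqf.symm)
  · -- four distinct mid-edges, all sides of `f` other than `E`
    obtain ⟨s₁, t₁, hst₁, hs₁E, ht₁E, hs₁, ht₁, -⟩ := γ.sides_of_arcFace_last hT hf (γ.mk_mem_arcs hi) hpf
    obtain ⟨s₂, t₂, hst₂, hs₂E, ht₂E, hs₂, ht₂, -⟩ := γ.sides_of_arcFace_last hT hf (γ.mk_mem_arcs hk) hqf
    dsimp only at hs₁ ht₁ hs₂ ht₂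
    refine Side.not_four_ne_E s₁ t₁ s₂ t₂ hs₁E ht₁E hs₂E ht₂E hst₁ ?_ ?_ ?_ ?_ hst₂ <;> intro heq <;>
      subst heq
    · have := (γ.nodup.getElem_inj_iff).1 (hs₁.symm.trans hs₂); omega
    · have := (γ.nodup.getElem_inj_iff).1 (hs₁.symm.trans ht₂); omega
    · have := (γ.nodup.getElem_inj_iff).1 (ht₁.symm.trans hs₂); omega
    · have := (γ.nodup.getElem_inj_iff).1 (ht₁.symm.trans ht₂); omega

/-- The kind of the (unique) arc in a face of the last column. [cite: GlazmanManolescu2019, proof of Lemma 4.3] -/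
def lastKind (γ : YBWalk (strip T) (boundaryPoint m) (boundaryPoint n)) (f : Face) : ArcKind :=
  (γ.kindsIn f).head?.getD .degen

/-- **Structure of a visited face of the last column**: it carries exactly one arc `p`, joining
two distinct sides `s, t ≠ E`, and `kindsIn` is the singleton `[arcKind s t]` (`u₁`-type `{W,N}`,
`u₂`-type `{W,S}` or `v`-type `{N,S}`).
[cite: GlazmanManolescu2019, proof of Lemma 4.3 ("an arc χ_j is formed of a rhombus of type u₁, a number k ≥ 0 of rhombi of type v and one rhombus of type u₂")] -/
theorem last_face_structure (hT : 1 ≤ T) (γ : YBWalk (strip T) (boundaryPoint m) (boundaryPoint n))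
    {f : Face} (hfv : f ∈ γ.facesVisited) (hf : f.1 = (T : ℤ) - 1) :
    ∃ p ∈ γ.arcs, arcFace p = some f ∧ (∀ q ∈ γ.arcs, arcFace q = some f → q = p) ∧
      ∃ s t : Side, s ≠ t ∧ s ≠ .E ∧ t ≠ .E ∧ f.side s = p.1 ∧ f.side t = p.2 ∧
        γ.kindsIn f = [arcKind s t] ∧ γ.lastKind f = arcKind s t := by
  obtain ⟨p, hp, hpf⟩ := γ.exists_arc_of_mem_facesVisited hfv
  obtain ⟨s, t, hst, hsE, htE, hs, ht, hk⟩ := γ.sides_of_arcFace_last hT hf hp hpf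
  have huniq : ∀ q ∈ γ.arcs, arcFace q = some f → q = p := fun q hq hqf =>
    γ.arc_unique_last hT hf hq hp hqf hpf
  have hkinds : γ.kindsIn f = [arcKind s t] := γ.kindsIn_eq_singleton hp hpf huniq hk
  exact ⟨p, hp, hpf, huniq, s, t, hst, hsE, htE, hs, ht, hkinds, by simp [lastKind, hkinds]⟩

end YBWalk

/-- Kinds of arcs avoiding the side `E`. [folklore] -/
theorem arcKind_cases {s t : Side} (hst : s ≠ t) (hs : s ≠ .E) (ht : t ≠ .E) :
    arcKind s t = .corner ∨ arcKind s t = .coCorner ∨ arcKind s t = .straight := by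
  cases s <;> cases t <;> simp_all [arcKind]

/-- An arc avoiding `E` uses the bottom side `S` iff it is not of `u₁`-type. [folklore] -/
theorem arcKind_ne_corner_iff {s t : Side} (hst : s ≠ t) (hs : s ≠ .E) (ht : t ≠ .E) :
    arcKind s t ≠ .corner ↔ (s = .S ∨ t = .S) := by
  cases s <;> cases t <;> simp_all [arcKind]

/-- An arc avoiding `E` uses the top side `N` iff it is not of `u₂`-type. [folklore] -/
theorem arcKind_ne_coCorner_iff {s t : Side} (hst : s ≠ t) (hs : s ≠ .E) (ht : t ≠ .E) :
    arcKind s t ≠ .coCorner ↔ (s = .N ∨ t = .N) := by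
  cases s <;> cases t <;> simp_all [arcKind]

/-- A product of a three-valued function is a product of three powers. [folklore] -/
theorem prod_eq_pow_three {α : Type*} [DecidableEq α] (s : Finset α) (κ : α → ArcKind)
    (hκ : ∀ x ∈ s, κ x = .corner ∨ κ x = .coCorner ∨ κ x = .straight) (g : ArcKind → ℝ) :
    ∏ x ∈ s, g (κ x) = g .corner ^ (s.filter (κ · = .corner)).card *
      g .coCorner ^ (s.filter (κ · = .coCorner)).card * g .straight ^ (s.filter (κ · = .straight)).card := by
  induction s using Finset.induction_on with
  | empty => simp
  | insert x s hx ih =>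
    rw [Finset.prod_insert hx, ih fun y hy => hκ y (Finset.mem_insert_of_mem hy)]
    simp only [Finset.filter_insert]
    rcases hκ x (Finset.mem_insert_self x s) with h | h | h <;>
      simp [h, Finset.card_insert_of_notMem, hx, pow_succ] <;> ring

/-- The rows `j` of the crossed bottom/top edges `slant K j` of column `K`. [folklore] -/
def slantRow (K : ℤ) : MidEdge → Option ℤ
  | .slant k j => if k = K then some j else none
  | .vert _ _ => none

/-- `slantRow K` recognises exactly the edges `slant K j`. [folklore] -/
theorem slantRow_eq_some_iff (K : ℤ) (e : MidEdge) (j : ℤ) : slantRow K e = some j ↔ e = .slant K j := by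
  cases e <;> simp [slantRow]

namespace YBWalk

variable {T : ℕ} {m n : ℤ}

/-- **The number of `u₁`-type faces equals the number of `u₂`-type faces in the last column**:
both the faces whose arc uses their bottom side and the faces whose arc uses their top side are
in bijection with the crossed slanted edges of the column (each such edge, never an endpoint, has
one arc below and one above it). [cite: GlazmanManolescu2019, proof of Lemma 4.3 ("an arc χ_j is formed of a rhombus of type u₁, … and one rhombus of type u₂")] -/
theorem card_corner_eq_card_coCorner (hT : 1 ≤ T) (γ : YBWalk (strip T) (boundaryPoint m) (boundaryPoint n)) :
    ((γ.facesVisited.filter fun f => f.1 = (T : ℤ) - 1).filter fun f => γ.lastKind f = .corner).card =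
      ((γ.facesVisited.filter fun f => f.1 = (T : ℤ) - 1).filter fun f => γ.lastKind f = .coCorner).card := by
  classical
  set K : ℤ := (T : ℤ) - 1 with hK
  set LF := γ.facesVisited.filter fun f => f.1 = K with hLF
  set J : Finset ℤ := (γ.mids.filterMap (slantRow K)).toFinset with hJ
  have memJ : ∀ j, j ∈ J ↔ MidEdge.slant K j ∈ γ.mids := fun j => by
    simp only [hJ, List.mem_toFinset, List.mem_filterMap, slantRow_eq_some_iff]
    constructor
    · rintro ⟨e, he, rfl⟩; exact he
    · intro h; exact ⟨_, h, rfl⟩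
  have memLF : ∀ f, f ∈ LF ↔ f ∈ γ.facesVisited ∧ f.1 = K := fun f => Finset.mem_filter
  -- a crossed slanted edge of column `K` has arcs in both faces it borders
  have slant_faces : ∀ j, MidEdge.slant K j ∈ γ.mids → ∀ f : Face, (f = ((K, j - 1) : Face) ∨ f = (K, j)) →
      f ∈ LF ∧ ∃ p ∈ γ.arcs, arcFace p = some f ∧ (∀ q ∈ γ.arcs, arcFace q = some f → q = p) ∧
        ∃ s t : Side, s ≠ t ∧ s ≠ .E ∧ t ≠ .E ∧ f.side s = p.1 ∧ f.side t = p.2 ∧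
          γ.lastKind f = arcKind s t ∧ (p.1 = .slant K j ∨ p.2 = .slant K j) := by
    intro j hj f hf
    have hff : f = (MidEdge.slant K j).faces.1 ∨ f = (MidEdge.slant K j).faces.2 := by
      simpa [MidEdge.faces] using hf
    obtain ⟨-, q, hq, hqf, hqe⟩ := γ.faces_of_interior hj (by simp [boundaryPoint]) (by simp [boundaryPoint]) f hff
    have hf1 : f.1 = K := by rcases hf with rfl | rfl <;> rfl
    have hfv : f ∈ γ.facesVisited := γ.mem_facesVisited_of_arcFace hq hqf
    obtain ⟨p, hp, hpf, huniq, s, t, hst, hsE, htE, hs, ht, -, hlk⟩ := γ.last_face_structure hT hfv hf1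
    obtain rfl := huniq q hq hqf
    exact ⟨(memLF f).2 ⟨hfv, hf1⟩, q, hp, hpf, huniq, s, t, hst, hsE, htE, hs, ht, hlk, hqe⟩
  -- faces whose arc uses the bottom side ↔ crossed slanted edges
  have hS : (LF.filter fun f => γ.lastKind f ≠ .corner).card = J.card := by
    apply Finset.card_nbij (fun f : Face => f.2)
    · intro f hf
      simp only [Finset.coe_filter, Set.mem_setOf_eq, memLF] at hf
      obtain ⟨⟨hfv, hf1⟩, hk⟩ := hf
      obtain ⟨p, hp, -, -, s, t, hst, hsE, htE, hs, ht, -, hlk⟩ := γ.last_face_structure hT hfv hf1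
      rw [hlk, arcKind_ne_corner_iff hst hsE htE] at hk
      obtain ⟨h1, h2, -⟩ := γ.mem_of_mem_arcs hp
      have : f.side .S ∈ γ.mids := by
        rcases hk with rfl | rfl
        · exact hs ▸ h1
        · exact ht ▸ h2
      simp only [Finset.mem_coe, memJ]
      simpa [Face.side, hf1] using this
    · intro f hf f' hf' h
      simp only [Finset.coe_filter, Set.mem_setOf_eq, memLF] at hf hf'
      exact Prod.ext (hf.1.2.trans hf'.1.2.symm) h
    · intro j hj
      simp only [Finset.mem_coe, memJ] at hj
      obtain ⟨hLF', p, hp, hpf, -, s, t, hst, hsE, htE, hs, ht, hlk, hpe⟩ :=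
        slant_faces j hj (K, j) (Or.inr rfl)
      refine ⟨(K, j), ?_, rfl⟩
      simp only [Finset.coe_filter, Set.mem_setOf_eq]
      refine ⟨hLF', ?_⟩
      rw [hlk, arcKind_ne_corner_iff hst hsE htE]
      have hS' : Face.side (K, j) .S = .slant K j := rfl
      rcases hpe with h | h
      · left; exact Face.side_injective _ (hs.trans (h.trans hS'.symm))
      · right; exact Face.side_injective _ (ht.trans (h.trans hS'.symm))
  -- faces whose arc uses the top side ↔ crossed slanted edges
  have hN : (LF.filter fun f => γ.lastKind f ≠ .coCorner).card = J.card := by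
    apply Finset.card_nbij (fun f : Face => f.2 + 1)
    · intro f hf
      simp only [Finset.coe_filter, Set.mem_setOf_eq, memLF] at hf
      obtain ⟨⟨hfv, hf1⟩, hk⟩ := hf
      obtain ⟨p, hp, -, -, s, t, hst, hsE, htE, hs, ht, -, hlk⟩ := γ.last_face_structure hT hfv hf1
      rw [hlk, arcKind_ne_coCorner_iff hst hsE htE] at hk
      obtain ⟨h1, h2, -⟩ := γ.mem_of_mem_arcs hp
      have : f.side .N ∈ γ.mids := by
        rcases hk with rfl | rfl
        · exact hs ▸ h1
        · exact ht ▸ h2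
      simp only [Finset.mem_coe, memJ]
      simpa [Face.side, hf1] using this
    · intro f hf f' hf' h
      simp only [Finset.coe_filter, Set.mem_setOf_eq, memLF] at hf hf'
      exact Prod.ext (hf.1.2.trans hf'.1.2.symm) (by simpa using h)
    · intro j hj
      simp only [Finset.mem_coe, memJ] at hj
      obtain ⟨hLF', p, hp, hpf, -, s, t, hst, hsE, htE, hs, ht, hlk, hpe⟩ :=
        slant_faces j hj (K, j - 1) (Or.inl rfl)
      refine ⟨(K, j - 1), ?_, by simp⟩
      simp only [Finset.coe_filter, Set.mem_setOf_eq]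
      refine ⟨hLF', ?_⟩
      rw [hlk, arcKind_ne_coCorner_iff hst hsE htE]
      have hN' : Face.side (K, j - 1) .N = .slant K j := by simp [Face.side]
      rcases hpe with h | h
      · left; exact Face.side_injective _ (hs.trans (h.trans hN'.symm))
      · right; exact Face.side_injective _ (ht.trans (h.trans hN'.symm))
  have h1 := Finset.card_filter_add_card_filter_not (s := LF) (fun f => γ.lastKind f = .corner)
  have h2 := Finset.card_filter_add_card_filter_not (s := LF) (fun f => γ.lastKind f = .coCorner)
  simp only [hS] at h1
  simp only [hN] at h2
  omega

end YBWalk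

/-! ### The weight of the last column and Lemma 4.3 -/

namespace YBWalk

variable {T : ℕ} {m n : ℤ}

/-- **The weight of the last column** of a walk between left-boundary points is
`u₁(θ)^{n₁} u₂(θ)^{n₂} v(θ)^{n₃}`, `nᵢ` the numbers of its faces of each type.
[cite: GlazmanManolescu2019, proof of Lemma 4.3, eq. (4.3)] -/
theorem prod_last_eq (hT : 1 ≤ T) (γ : YBWalk (strip T) (boundaryPoint m) (boundaryPoint n)) (θ : ℝ) :
    ∏ f ∈ γ.facesVisited.filter (fun f => f.1 = (T : ℤ) - 1), localWeight θ (γ.kindsIn f) =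
      weightU1 θ ^ ((γ.facesVisited.filter fun f => f.1 = (T : ℤ) - 1).filter
          fun f => γ.lastKind f = .corner).card *
      weightU2 θ ^ ((γ.facesVisited.filter fun f => f.1 = (T : ℤ) - 1).filter
          fun f => γ.lastKind f = .coCorner).card *
      weightV θ ^ ((γ.facesVisited.filter fun f => f.1 = (T : ℤ) - 1).filter
          fun f => γ.lastKind f = .straight).card := by
  have hmem : ∀ f ∈ γ.facesVisited.filter (fun f => f.1 = (T : ℤ) - 1),
      γ.kindsIn f = [γ.lastKind f] ∧
        (γ.lastKind f = .corner ∨ γ.lastKind f = .coCorner ∨ γ.lastKind f = .straight) := by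
    intro f hf
    rw [Finset.mem_filter] at hf
    obtain ⟨p, -, -, -, s, t, hst, hsE, htE, -, -, hk, hlk⟩ := γ.last_face_structure hT hf.1 hf.2
    rw [hk, hlk]
    exact ⟨rfl, arcKind_cases hst hsE htE⟩
  rw [Finset.prod_congr rfl fun f hf => by rw [(hmem f hf).1]]
  rw [prod_eq_pow_three _ γ.lastKind (fun f hf => (hmem f hf).2) fun k => localWeight θ [k]]
  rfl

/-- **The last column weighs least at `π/3`** (given the walk): with as many `u₁`- as `u₂`-faces,
its weight is `(u₁u₂)(θ)^{p} v(θ)^{q}`, and both `u₁u₂` and `v` are minimal at `π/3`.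
[cite: GlazmanManolescu2019, proof of Lemma 4.3] -/
theorem prod_last_pi_div_three_le (hT : 1 ≤ T) (γ : YBWalk (strip T) (boundaryPoint m) (boundaryPoint n))
    {θ : ℝ} (hθ : θ ∈ Set.Icc (π / 3) (2 * π / 3)) :
    ∏ f ∈ γ.facesVisited.filter (fun f => f.1 = (T : ℤ) - 1), localWeight (π / 3) (γ.kindsIn f) ≤
      ∏ f ∈ γ.facesVisited.filter (fun f => f.1 = (T : ℤ) - 1), localWeight θ (γ.kindsIn f) := by
  rw [γ.prod_last_eq hT, γ.prod_last_eq hT, ← γ.card_corner_eq_card_coCorner hT, ← mul_pow, ← mul_pow]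
  have h3 := pi_div_three_mem_Icc
  apply mul_le_mul
  · exact pow_le_pow_left₀ (mul_nonneg (weightU1_nonneg h3) (weightU2_nonneg h3))
      (weightU1U2_pi_div_three_le hθ) _
  · exact pow_le_pow_left₀ (weightV_nonneg h3) (weightV_pi_div_three_le hθ) _
  · exact pow_nonneg (weightV_nonneg h3) _
  · exact pow_nonneg (mul_nonneg (weightU1_nonneg hθ) (weightU2_nonneg hθ)) _

/-- **Lemma 4.3, per walk**: replacing the angle of the last column by `π/3` does not increase
the weight of a walk between left-boundary points ("any self-avoiding walk γ from a to b in
`Strip_T(Θ)` has either the same or larger weight than its correspondent walk in `Strip_T(Θ̃)`").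
[cite: GlazmanManolescu2019, proof of Lemma 4.3] -/
theorem weight_update_last_le (hT : 1 ≤ T) (γ : YBWalk (strip T) (boundaryPoint m) (boundaryPoint n))
    {Θ : ℤ → ℝ} (hΘ : ∀ k, Θ k ∈ Set.Icc (π / 3) (2 * π / 3)) :
    γ.weight (Function.update Θ ((T : ℤ) - 1) (π / 3)) ≤ γ.weight Θ := by
  unfold weight
  rw [← Finset.prod_filter_mul_prod_filter_not γ.facesVisited (fun f => f.1 = (T : ℤ) - 1),
    ← Finset.prod_filter_mul_prod_filter_not γ.facesVisited (fun f => f.1 = (T : ℤ) - 1)]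
  have hlast : ∀ Θ' : ℤ → ℝ, ∏ f ∈ γ.facesVisited.filter (fun f => f.1 = (T : ℤ) - 1),
      localWeight (Θ' f.1) (γ.kindsIn f) =
      ∏ f ∈ γ.facesVisited.filter (fun f => f.1 = (T : ℤ) - 1), localWeight (Θ' ((T : ℤ) - 1)) (γ.kindsIn f) :=
    fun Θ' => Finset.prod_congr rfl fun f hf => by rw [(Finset.mem_filter.1 hf).2]
  have hrest : ∏ f ∈ γ.facesVisited.filter (fun f => ¬f.1 = (T : ℤ) - 1),
      localWeight (Function.update Θ ((T : ℤ) - 1) (π / 3) f.1) (γ.kindsIn f) =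
      ∏ f ∈ γ.facesVisited.filter (fun f => ¬f.1 = (T : ℤ) - 1), localWeight (Θ f.1) (γ.kindsIn f) :=
    Finset.prod_congr rfl fun f hf => by rw [Function.update_of_ne (Finset.mem_filter.1 hf).2]
  rw [hlast, hlast Θ, hrest, Function.update_self]
  exact mul_le_mul_of_nonneg_right (γ.prod_last_pi_div_three_le hT (hΘ _))
    (Finset.prod_nonneg fun f _ => localWeight_nonneg (hΘ _) _)

end YBWalk

/-- **Glazman–Manolescu, Lemma 4.3** (discharge of `GlazmanManolescu2019_lem43`): summing
`YBWalk.weight_update_last_le` over all walks. [cite: GlazmanManolescu2019, Lemma 4.3] -/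
theorem GlazmanManolescu2019_lem43_holds : GlazmanManolescu2019_lem43 := by
  intro T Θ hT hΘ m n
  unfold twoPoint
  exact ENNReal.tsum_le_tsum fun γ => ENNReal.ofReal_le_ofReal (γ.weight_update_last_le hT hΘ)

/-! ### Corollary 4.4 and Theorem 2 from Corollary 2.3, Proposition 1.1 and Proposition 4.2 -/

/-- **Glazman–Manolescu, Corollary 4.4, eq. (4.5), from Proposition 4.2 alone** (Lemma 4.3 being
discharged above): "Let `Θ = (θ_1, …, θ_T)` be a finite sequence of angles with `θ_k ∈ [π/3, 2π/3]`
for all `k`. Then for any two points `a, b` on the left boundary of `Strip_T(Θ)` …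
`G_{Strip_T(Θ)}(a, b) ≥ G_{Strip_T(π/3)}(a, b)`, where the right hand side is the strip of width `T`
with all angles equal to `π/3`." The printed proof — Lemma 4.3, then Proposition 4.2 to rotate the
`π/3` column to the front, `T` times — is `GlazmanManolescu2019_cor44_of` (`YangBaxterSAWTwoPoint.lean`);
Corollary 4.4 is therefore not vendored as a separate named fact.
[cite: GlazmanManolescu2019, Corollary 4.4, eq. (4.5)] -/
theorem GlazmanManolescu2019_cor44_of_prop42 (h42 : GlazmanManolescu2019_prop42) (T : ℕ) (Θ : ℤ → ℝ)
    (hΘ : ∀ k, Θ k ∈ Set.Icc (π / 3) (2 * π / 3)) (m n : ℤ) :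
    twoPoint (strip T) (fun _ => π / 3) (boundaryPoint m) (boundaryPoint n) ≤
      twoPoint (strip T) Θ (boundaryPoint m) (boundaryPoint n) :=
  GlazmanManolescu2019_cor44_of h42 GlazmanManolescu2019_lem43_holds T Θ hΘ m n

/-- `A_{T,π/3} ≤ A_{T,Θ}` (Corollary 4.4, eq. (4.5), summed over the rows), from Proposition 4.2.
[cite: GlazmanManolescu2019, §4.2 ("A_{T,Θ} = Σ_L G_{S_T(Θ)}(0,L) ≥ Σ_L G_{T,(π/3)}(0,L) = A_{T,(π/3)}")] -/
theorem arcPartitionFunction_hex_le (h42 : GlazmanManolescu2019_prop42) {Θ : ℤ → ℝ}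
    (hΘ : ∀ k, Θ k ∈ Set.Icc (π / 3) (2 * π / 3)) (T : ℕ) :
    arcPartitionFunction T (fun _ => π / 3) ≤ arcPartitionFunction T Θ := by
  refine ENNReal.tsum_le_tsum fun L => ?_
  split_ifs
  · exact le_rfl
  · exact GlazmanManolescu2019_cor44_of_prop42 h42 T Θ hΘ 0 L

/-- **Bridges are heaviest on the hexagonal lattice**: `B_{T,Θ} ≤ B_{T,π/3}` for `T ≥ 1`, from
`cos(3π/8) A + B = 1` (Cor. 2.3) and `A_{T,Θ} ≥ A_{T,π/3}` (Cor. 4.4, i.e. Prop. 4.2 + Lemma 4.3).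
[cite: GlazmanManolescu2019, §4.3 (proof of Theorem 2)] -/
theorem bridgePartitionFunction_le_hex (h23 : GlazmanManolescu2019_cor23) (h42 : GlazmanManolescu2019_prop42)
    {Θ : ℤ → ℝ} (hΘ : ∀ k, Θ k ∈ Set.Icc (π / 3) (2 * π / 3)) {T : ℕ} (hT : 1 ≤ T) :
    bridgePartitionFunction T Θ ≤ bridgePartitionFunction T (fun _ => π / 3) := by
  have hhex : ∀ k : ℤ, (fun _ => π / 3 : ℤ → ℝ) k ∈ Set.Icc (π / 3) (2 * π / 3) :=
    fun _ => pi_div_three_mem_Icc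
  have h1 := h23 Θ hΘ T hT
  have h2 := h23 _ hhex T hT
  set c := ENNReal.ofReal (Real.cos (3 * π / 8))
  have hA : c * arcPartitionFunction T (fun _ => π / 3) ≤ c * arcPartitionFunction T Θ := by
    gcongr; exact arcPartitionFunction_hex_le h42 hΘ T
  have hfin : c * arcPartitionFunction T Θ ≠ ⊤ := ne_top_of_le_ne_top ENNReal.one_ne_top (h1 ▸ le_self_add)
  calc bridgePartitionFunction T Θ = 1 - c * arcPartitionFunction T Θ :=
        ENNReal.eq_sub_of_add_eq' ENNReal.one_ne_top (by rw [add_comm]; exact h1)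
    _ ≤ 1 - c * arcPartitionFunction T (fun _ => π / 3) := tsub_le_tsub_left hA 1
    _ = bridgePartitionFunction T (fun _ => π / 3) := by
        rw [← h2, add_comm, ENNReal.add_sub_cancel_right]
        exact ne_top_of_le_ne_top ENNReal.one_ne_top (h2 ▸ le_self_add)

/-- **Theorem 2 from Corollary 2.3, Proposition 1.1 (`B_T(π/3) → 0`) and Proposition 4.2**
(Lemma 4.3 being discharged): `0 ≤ B_{T,Θ} ≤ B_{T,π/3} → 0`. (The printed proof, §4.3, goes
through `A_{T,Θ} → 1/cos(3π/8)`, established in the proof of Theorem 1 from the same inputs.)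
[cite: GlazmanManolescu2019, Theorem 2 (proof, §4.3)] -/
theorem GlazmanManolescu2019_thm2_of (h23 : GlazmanManolescu2019_cor23)
    (h11 : GlazmanManolescu2019_prop11_limit) (h42 : GlazmanManolescu2019_prop42) :
    GlazmanManolescu2019_thm2 := by
  intro Θ hΘ
  refine tendsto_of_tendsto_of_tendsto_of_le_of_le' tendsto_const_nhds h11
    (Eventually.of_forall fun T => zero_le) ?_
  filter_upwards [eventually_ge_atTop 1] with T hT
  exact bridgePartitionFunction_le_hex h23 h42 hΘ hT

/-- **Theorem 1 from Corollary 2.3, Proposition 1.1 (`B_T(π/3) → 0`) and Proposition 4.2**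
(Lemma 4.3 being discharged): the assembly `GlazmanManolescu2019_thm1_of` of
`YangBaxterSAWTwoPoint.lean` fed with Corollary 4.4 in the form `GlazmanManolescu2019_cor44_of`.
[cite: GlazmanManolescu2019, Theorem 1 (proof, §4.2)] -/
theorem GlazmanManolescu2019_thm1_of_cor23_prop11_prop42 (h23 : GlazmanManolescu2019_cor23)
    (h11 : GlazmanManolescu2019_prop11_limit) (h42 : GlazmanManolescu2019_prop42) :
    GlazmanManolescu2019_thm1 :=
  GlazmanManolescu2019_thm1_of h23 h11 (GlazmanManolescu2019_cor44_of h42 GlazmanManolescu2019_lem43_holds)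

/-- **Theorem 2 from Corollary 2.3, Proposition 1.1 (`B_T(π/3) → 0`) and Proposition 4.2**: the
name used downstream (`GlazmanManolescu2019_thm2_of_lem21`, `YangBaxterSAWObservable.lean`) for
`GlazmanManolescu2019_thm2_of`. [cite: GlazmanManolescu2019, Theorem 2 (proof, §4.3)] -/
theorem GlazmanManolescu2019_thm2_of_cor23_prop11_prop42 (h23 : GlazmanManolescu2019_cor23)
    (h11 : GlazmanManolescu2019_prop11_limit) (h42 : GlazmanManolescu2019_prop42) :
    GlazmanManolescu2019_thm2 :=
  GlazmanManolescu2019_thm2_of h23 h11 h42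

end Literature.Probability.RandomPlanarGeometry.SAW.YangBaxter
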